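import Literature.AlgebraicTopology.KTheory.MappingCone
import Literature.AlgebraicTopology.KTheory.StableQuotient
import Literature.AlgebraicTopology.KTheory.ReducedSphereVanishing
import Literature.AlgebraicTopology.KTheory.CoverTrivial
import Literature.AlgebraicTopology.KTheory.ClutchingStablyTrivial
import HarnessLib

/-!
# `K`-theory of the mapping cone of the Hopf construction

For the cone `C = C_ĝ` of `MappingCone.lean` (bottom sphere `j : Sᵈ → C`, top cell
`Φ : Dᵈ × Dᵈ → C`) we prove the two halves of the short exact sequence
`0 → K̃(C/Sᵈ) → K̃(C) → K̃(Sᵈ) → 0` of Hatcher, *VBKT* §2.3 (proof of Thm. 2.19) that are not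
formal consequences of `Exactness.lean`:

* §1 matrices of functions on the cone from compatible pairs on `Dᵈ × Dᵈ` and `Sᵈ` (`coneMat`);
* §2 **extension of stably null-homotopic invertible matrices from `Sᵈ` over `C`**
  (`cone_stable_extend`: radial extension of the null-homotopy along `θ₂`, i.e. over the cone on
  `ĝ`, then descent), hence **injectivity of `q^* : K̃(C/Sᵈ) → K⁰(C)`** from the stable criterion
  (`cone_eq_zero_of_quotK_eq_zero`); the stable null-homotopy is an input (for `d` even it comes
  from `K̃(Sᵈ⁺¹) = 0`, `ClutchingStablyTrivial.lean`);
* §3 **surjectivity of `j^* : K⁰(C) → K⁰(Sᵈ)` up to trivial classes** when `K̃(∂(Dᵈ × Dᵈ)) = 0`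
  (`cone_exists_lift`: `ĝ^* P` is stably trivial, so `P ⊕ 1 ⊕ 0` pulled back to the boundary is
  conjugate by a Whitehead lift to a constant idempotent, which extends over the cell and glues).

Everything is proved; no named facts.

## References

* A. Hatcher, *Vector Bundles and K-Theory* (v2.2, 2017), §2.3: the exact sequence
  `0 → K̃(S⁴ⁿ) → K̃(C_f) → K̃(S²ⁿ) → 0` in the proof of Thm. 2.19, Prop. 2.9. [HatcherVBKT2017]
* J. F. Adams, M. F. Atiyah, `K`-theory and the Hopf invariant, Quart. J. Math. 17 (1966) 31–38.
  [AdamsAtiyah1966]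
-/

noncomputable section

namespace Literature.AlgebraicTopology.KTheory

open Literature.RingTheory.KTheory Matrix Set Metric TopologicalSpace

variable {d : ℕ} (g : C(Sd1 d × Sd1 d, Sd1 d)) (e₀ : Sd1 d)

/-! ### 1. Matrices of functions on the cone -/

section ConeMat

variable {m n : Type*}

/-- A matrix of functions on the cone from a compatible pair of matrices of functions on the
cell and on the bottom sphere. [folklore] -/
def coneMat (FD : Matrix m n C(DD d, ℂ)) (FS : Matrix m n C(SW d, ℂ))
    (h : ∀ i j w (hw : rad w = 1), FD i j w = FS i j (bdryVal g e₀ w hw)) : Matrix m n C(Cone g e₀, ℂ) :=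
  Matrix.of fun i j ↦ coneLift g e₀ (FD i j) (FS i j) (h i j)

/-- K-theory of the mapping cone (Hatcher VBKT §2.3). [folklore] -/
theorem coneMat_map_conePhi (FD : Matrix m n C(DD d, ℂ)) (FS : Matrix m n C(SW d, ℂ)) (h) :
    (coneMat g e₀ FD FS h).map (comapRingHom (conePhi g e₀)) = FD := by
  ext i j w
  exact coneLift_conePhi g e₀ (FD i j) (FS i j) (h i j) w

/-- K-theory of the mapping cone (Hatcher VBKT §2.3). [folklore] -/
theorem coneMat_map_coneJ (FD : Matrix m n C(DD d, ℂ)) (FS : Matrix m n C(SW d, ℂ)) (h) :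
    (coneMat g e₀ FD FS h).map (comapRingHom (coneJ g e₀)) = FS := by
  ext i j p
  exact coneLift_coneJ g e₀ (FD i j) (FS i j) (h i j) p

/-- Matrices of functions on the cone are determined by their pull-backs to the cell and to the
bottom sphere. [folklore] -/
theorem cone_matrix_ext {M N : Matrix m n C(Cone g e₀, ℂ)} (hD : M.map (comapRingHom (conePhi g e₀)) = N.map (comapRingHom (conePhi g e₀)))
    (hS : M.map (comapRingHom (coneJ g e₀)) = N.map (comapRingHom (coneJ g e₀))) : M = N := by
  ext i j c
  rcases cone_cases g e₀ c with ⟨w, -, rfl⟩ | ⟨p, rfl⟩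
  · exact congrFun (congrArg DFunLike.coe (congrFun (congrFun hD i) j)) w
  · exact congrFun (congrArg DFunLike.coe (congrFun (congrFun hS i) j)) p

/-- Pull-back of functions along a surjection is injective. [folklore] -/
theorem comapRingHom_injective_of_surjective {X Y : Type*} [TopologicalSpace X] [TopologicalSpace Y] (f : C(X, Y))
    (hf : Function.Surjective f) : Function.Injective (comapRingHom f) := by
  intro a b h
  ext y
  obtain ⟨x, rfl⟩ := hf y
  exact congrFun (congrArg DFunLike.coe h) x

/-- K-theory of the mapping cone (Hatcher VBKT §2.3). [folklore] -/
theorem matrix_map_comapRingHom_injective {X Y : Type*} [TopologicalSpace X] [TopologicalSpace Y] (f : C(X, Y))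
    (hf : Function.Surjective f) {M N : Matrix m n C(Y, ℂ)} (h : M.map (comapRingHom f) = N.map (comapRingHom f)) : M = N :=
  Matrix.ext fun i j ↦ comapRingHom_injective_of_surjective f hf (congrFun (congrFun h i) j)

end ConeMat

/-! ### 2. Extension of stably null-homotopic invertible matrices; injectivity of `q^*` -/

section Extend

/-- The hypothesis "every invertible matrix-valued map on `Sᵈ` is stably null-homotopic through
invertible matrices", in the form consumed below. [cite: HatcherVBKT2017, §1.2 Prop. 1.11] -/
def StablyNullhomotopic (d : ℕ) : Prop :=
  ∀ (N : ℕ) (F : C(SW d, Matrix (Fin N) (Fin N) ℂ)), (∀ q, IsUnit (F q).det) →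
    ∃ (a : ℕ) (H : C(SW d × unitInterval, Matrix (Fin a ⊕ Fin N) (Fin a ⊕ Fin N) ℂ)),
      (∀ q, H (q, 0) = 1) ∧ (∀ q, H (q, 1) = Matrix.fromBlocks 1 0 0 (F q)) ∧ ∀ z, IsUnit (H z).det

/-- `θ₂` as a map into the closed unit ball of `ℝᵈ × ℝ`. [cite: HatcherVBKT2017, §2.3 Lemma 2.18] -/
def theta2Ball : C(DD d, ↥(closedBall (0 : Wd d) 1)) :=
  ⟨fun w ↦ ⟨theta2 g e₀ w, mem_closedBall_zero_iff.2 (by rw [norm_theta2]; exact rad_le_one w)⟩,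
    (continuous_theta2 g e₀).subtype_mk _⟩

/-- K-theory of the mapping cone (Hatcher VBKT §2.3). [folklore] -/
@[simp] theorem coe_theta2Ball (w : DD d) : ((theta2Ball g e₀ w : ↥(closedBall (0 : Wd d) 1)) : Wd d) = theta2 g e₀ w := rfl

/-- **Null-homotopic invertible matrices on `Sᵈ` extend invertibly over the cone**: radially
over the ball along `θ₂` (`ballExt`), i.e. `w ↦ H(θ₂(w)/|θ₂(w)|, |θ₂(w)|)`, and then by descent. [cite: HatcherVBKT2017, §2.3 proof of Thm. 2.19] -/
theorem exists_cone_extend_of_homotopy {N : Type*} [Fintype N] [DecidableEq N]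
    (F : C(SW d, Matrix N N ℂ)) (H : C(SW d × unitInterval, Matrix N N ℂ))
    (hH0 : ∀ q, H (q, 0) = 1) (hH1 : ∀ q, H (q, 1) = F q) (hHu : ∀ z, IsUnit (H z).det) :
    ∃ G G' : Matrix N N C(Cone g e₀, ℂ), G * G' = 1 ∧ G' * G = 1 ∧ G.map (comapRingHom (coneJ g e₀)) = matrixUnswap F := by
  -- the radial extension over the cell
  set UD : C(DD d, Matrix N N ℂ) := (ballExtMap H 1 hH0).comp (theta2Ball g e₀) with hUD
  have hUDu : ∀ w, IsUnit (UD w).det := by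
    intro w
    change IsUnit (ballExt H 1 (theta2Ball g e₀ w)).det
    by_cases h0 : ((theta2Ball g e₀ w : ↥(closedBall (0 : Wd d) 1)) : Wd d) = 0
    · rw [ballExt, dif_pos h0, Matrix.det_one]; exact isUnit_one
    · rw [ballExt_of_ne_zero H 1 h0]; exact hHu _
  have hFu : ∀ q, IsUnit (F q).det := fun q ↦ by rw [← hH1 q]; exact hHu _
  have hcompat : ∀ w (hw : rad w = 1), UD w = F (bdryVal g e₀ w hw) := by
    intro w hw
    have h1 : ‖((theta2Ball g e₀ w : ↥(closedBall (0 : Wd d) 1)) : Wd d)‖ = 1 := by rw [coe_theta2Ball, norm_theta2, hw]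
    change ballExt H 1 (theta2Ball g e₀ w) = _
    rw [ballExt_of_norm_eq_one H 1 h1, hH1]
    rfl
  have hcompat' : ∀ w (hw : rad w = 1), invFamily UD hUDu w = invFamily F hFu (bdryVal g e₀ w hw) := by
    intro w hw; rw [invFamily_apply, invFamily_apply, hcompat w hw]
  -- descend
  set GC : C(Cone g e₀, Matrix N N ℂ) := coneLift g e₀ UD F hcompat with hGC
  set GC' : C(Cone g e₀, Matrix N N ℂ) := coneLift g e₀ (invFamily UD hUDu) (invFamily F hFu) hcompat' with hGC'
  have hmul : ∀ c, GC c * GC' c = 1 := by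
    intro c
    rcases cone_cases g e₀ c with ⟨w, -, rfl⟩ | ⟨p, rfl⟩
    · rw [hGC, hGC', coneLift_conePhi, coneLift_conePhi, invFamily_apply, Matrix.mul_nonsing_inv _ (hUDu w)]
    · rw [hGC, hGC', coneLift_coneJ, coneLift_coneJ, invFamily_apply, Matrix.mul_nonsing_inv _ (hFu p)]
  have hmul' : ∀ c, GC' c * GC c = 1 := by
    intro c
    rcases cone_cases g e₀ c with ⟨w, -, rfl⟩ | ⟨p, rfl⟩
    · rw [hGC, hGC', coneLift_conePhi, coneLift_conePhi, invFamily_apply, Matrix.nonsing_inv_mul _ (hUDu w)]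
    · rw [hGC, hGC', coneLift_coneJ, coneLift_coneJ, invFamily_apply, Matrix.nonsing_inv_mul _ (hFu p)]
  refine ⟨matrixUnswap GC, matrixUnswap GC', ?_, ?_, ?_⟩
  · apply matrixSwap_injective
    ext c : 1
    rw [matrixSwap_mul, matrixSwap_one]
    exact hmul c
  · apply matrixSwap_injective
    ext c : 1
    rw [matrixSwap_mul, matrixSwap_one]
    exact hmul' c
  · ext i j p
    change GC (coneJ g e₀ p) i j = F p i j
    rw [hGC, coneLift_coneJ]

/-- Transport of a matrix over `C(S, ℂ)`, `S ⊆ C` the bottom sphere, to a matrix-valued map on `Sᵈ`. [folklore] -/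
def toSphereFamily {r : Type*} (u : Matrix r r C(↥(coneSC g e₀ : Set (Cone g e₀)), ℂ)) : C(SW d, Matrix r r ℂ) :=
  matrixSwap (u.map (comapRingHom ((coneSHomeo g e₀ : SW d ≃ₜ ↥(coneSC g e₀ : Set (Cone g e₀))) : C(SW d, ↥(coneSC g e₀ : Set (Cone g e₀))))))

/-- K-theory of the mapping cone (Hatcher VBKT §2.3). [folklore] -/
theorem toSphereFamily_apply {r : Type*} (u : Matrix r r C(↥(coneSC g e₀ : Set (Cone g e₀)), ℂ)) (p : SW d) :
    toSphereFamily g e₀ u p = u.map (evalRingHom (coneSHomeo g e₀ p)) := rfl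

/-- K-theory of the mapping cone (Hatcher VBKT §2.3). [folklore] -/
theorem incl_comp_coneSHomeo :
    (incl (coneSC g e₀ : Set (Cone g e₀))).comp ((coneSHomeo g e₀ : SW d ≃ₜ ↥(coneSC g e₀ : Set (Cone g e₀))) : C(SW d, _)) = coneJ g e₀ :=
  ContinuousMap.ext fun _ ↦ rfl

/-- **The stable extension property of the pair `(C, Sᵈ)`**: every inverse pair of matrices of
functions on the bottom sphere extends invertibly over the cone after a block sum with an
identity matrix, provided invertible matrix-valued maps on `Sᵈ` are stably null-homotopic. [cite: HatcherVBKT2017, §2.3 proof of Thm. 2.19] -/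
theorem cone_stable_extend (hnull : StablyNullhomotopic d) (r : ℕ)
    (u u' : Matrix (Fin r) (Fin r) C(↥(coneSC g e₀ : Set (Cone g e₀)), ℂ)) (huu' : u * u' = 1) (_hu'u : u' * u = 1) :
    ∃ (s : ℕ) (G G' : Matrix (Fin s ⊕ Fin r) (Fin s ⊕ Fin r) C(Cone g e₀, ℂ)), G * G' = 1 ∧ G' * G = 1 ∧
      G.map (resHom (coneSC g e₀ : Set (Cone g e₀))) = Matrix.fromBlocks 1 0 0 u := by
  set F := toSphereFamily g e₀ u with hF
  have hFu : ∀ q, IsUnit (F q).det := by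
    intro q
    apply isUnit_det_of_mul_eq_one (M' := toSphereFamily g e₀ u' q)
    rw [hF, toSphereFamily_apply, toSphereFamily_apply, ← Matrix.map_mul, huu', Matrix.map_one _ (map_zero _) (map_one _)]
  obtain ⟨a, H, hH0, hH1, hHu⟩ := hnull r F hFu
  obtain ⟨G, G', hGG', hG'G, hGj⟩ := exists_cone_extend_of_homotopy g e₀ (blockOneFamily a F) H hH0 (fun q ↦ by rw [hH1, blockOneFamily_apply]) hHu
  refine ⟨a, G, G', hGG', hG'G, ?_⟩
  -- compare after pulling back along the homeomorphism `Sᵈ ≅ S`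
  apply matrix_map_comapRingHom_injective ((coneSHomeo g e₀ : SW d ≃ₜ ↥(coneSC g e₀ : Set (Cone g e₀))) : C(SW d, _))
    (coneSHomeo g e₀).surjective
  rw [Matrix.map_map, ← RingHom.coe_comp, ← comapRingHom_comp, incl_comp_coneSHomeo, hGj]
  ext i j p
  rw [matrixUnswap_apply, blockOneFamily_apply]
  rcases i with i | i <;> rcases j with j | j
  · simp [Matrix.fromBlocks_apply₁₁, Matrix.one_apply]
    split_ifs <;> rfl
  · simp [Matrix.fromBlocks_apply₁₂]; rfl
  · simp [Matrix.fromBlocks_apply₂₁]; rfl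
  · simp [Matrix.fromBlocks_apply₂₂, hF, toSphereFamily_apply]; rfl

/-- **Injectivity of `q^* : K̃(C/Sᵈ) → K⁰(C)`** for the mapping cone, under the stable
null-homotopy hypothesis on `Sᵈ`. [cite: HatcherVBKT2017, §2.3 proof of Thm. 2.19] -/
theorem cone_eq_zero_of_quotK_eq_zero (hnull : StablyNullhomotopic d) {b : K0 (Collapse (Cone g e₀) (coneSC g e₀))}
    (hb : b ∈ Reduced (Collapse (Cone g e₀) (coneSC g e₀)) (Collapse.pt (coneSC g e₀))) (h0 : quotK (coneSC g e₀) b = 0) : b = 0 :=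
  eq_zero_of_quotK_eq_zero_of_stable (fun r u u' h1 h2 ↦ cone_stable_extend g e₀ hnull r u u' h1 h2) hb h0

/-- `q^*` is injective on the reduced group of `C/Sᵈ`. [cite: HatcherVBKT2017, §2.3 proof of Thm. 2.19] -/
theorem cone_quotK_injOn_reduced (hnull : StablyNullhomotopic d) {b b' : K0 (Collapse (Cone g e₀) (coneSC g e₀))}
    (hb : b ∈ Reduced (Collapse (Cone g e₀) (coneSC g e₀)) (Collapse.pt (coneSC g e₀)))
    (hb' : b' ∈ Reduced (Collapse (Cone g e₀) (coneSC g e₀)) (Collapse.pt (coneSC g e₀)))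
    (h : quotK (coneSC g e₀) b = quotK (coneSC g e₀) b') : b = b' := by
  rw [← sub_eq_zero]
  exact cone_eq_zero_of_quotK_eq_zero g e₀ hnull (sub_mem hb hb') (by rw [map_sub, h, sub_self])

end Extend

/-! ### 3. Surjectivity of `j^*` up to trivial classes when `K̃(∂(Dᵈ × Dᵈ)) = 0` -/

section Lift

/-- The restriction `∂(Dᵈ × Dᵈ) → Sᵈ` of the Hopf construction (`ĝ` itself). [cite: HatcherVBKT2017, §2.3 Lemma 2.18] -/
def bdryToSW : C(↥(bdry d), SW d) :=
  ⟨fun w ↦ bdryVal g e₀ w.1 w.2, ((continuous_theta2 g e₀).comp continuous_subtype_val).subtype_mk _⟩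

/-- K-theory of the mapping cone (Hatcher VBKT §2.3). [folklore] -/
@[simp] theorem bdryToSW_apply (w : ↥(bdry d)) : bdryToSW g e₀ w = bdryVal g e₀ w.1 w.2 := rfl

/-- **Surjectivity of `j^* : K⁰(C) → K⁰(Sᵈ)` modulo trivial classes.** If the boundary of the
cell has vanishing reduced `K`-theory, then every idempotent over the bottom sphere extends, after
adding a trivial summand, to an idempotent over the cone: `ĝ^*(P ⊕ 1ₘ)` is conjugate over
`∂(Dᵈ × Dᵈ)` (by the involution of `exists_involution_conj`) to a constant, the Whitehead lift of
`w ⊕ w` over the cell conjugates a constant idempotent into an extension, and the two pieces glue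
by `coneLift`. [cite: HatcherVBKT2017, §2.3 proof of Thm. 2.19] -/
theorem cone_exists_lift {w₀ : ↥(bdry d)} (hbdry : Reduced (↥(bdry d)) w₀ = ⊥) (P : Idem C(SW d, ℂ)) :
    ∃ (Q : Idem C(Cone g e₀, ℂ)) (m : ℕ), pullback (coneJ g e₀) (KZero.of Q) = KZero.of P + KZero.of (Idem.unit m : Idem C(SW d, ℂ)) := by
  classical
  -- `ĝ^* P` has the class of a trivial idempotent: stabilise
  set p : Idem C(↥(bdry d), ℂ) := P.map (comapRingHom (bdryToSW g e₀)) with hp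
  set ρ : ℕ := (p.map (evalRingHom w₀)).rank with hρ
  have hcls : KZero.of p = KZero.of (Idem.unit ρ : Idem C(↥(bdry d), ℂ)) := by
    rw [eq_unitHom_rankAt_of_reduced_eq_bot hbdry (KZero.of p), rankAt_of, ← hρ, KZero.unitHom_eq_intCast, Int.cast_natCast,
      KZero.of_unit_eq_natCast]
  obtain ⟨m, hm⟩ := KZero.of_eq_of_iff_exists_unit.1 hcls
  rw [Idem.unit_add_unit] at hm
  -- the stabilised idempotent over the sphere and its pull-back to the boundary
  set P' : Idem C(SW d, ℂ) := Idem.unit m + P with hP'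
  set p' : Idem C(↥(bdry d), ℂ) := P'.map (comapRingHom (bdryToSW g e₀)) with hp'
  have hp'eq : p' = Idem.unit m + p := by rw [hp', hP', Idem.map_add, Idem.map_unit]
  have halg : AlgEquivalent p'.mat (1 : Matrix (Fin (m + ρ)) (Fin (m + ρ)) C(↥(bdry d), ℂ)) := by
    rw [hp'eq]; exact Idem.equiv_iff.1 hm
  -- the involution over the boundary
  set n := p'.size with hn
  obtain ⟨wv, hww, hconj⟩ := halg.exists_involution_conj
  -- Whitehead lift of `w ⊕ w` over the cell
  obtain ⟨la, hla⟩ := matrix_map_resHom_surjective isClosed_bdry wv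
  obtain ⟨lb, hlb⟩ := matrix_map_resHom_surjective isClosed_bdry (-wv)
  obtain ⟨L, L', hLL', hL'L, hLρ⟩ := exists_lift_fromBlocks (resHom (bdry d)) hww hww hla hlb
  set ρr : C(DD d, ℂ) →+* C(↥(bdry d), ℂ) := resHom (bdry d) with hρr
  have hL'ρ : L'.map ρr = Matrix.fromBlocks wv 0 0 wv := by
    have h2 : L'.map ρr * Matrix.fromBlocks wv 0 0 wv = 1 := by
      rw [← hLρ, ← Matrix.map_mul, hL'L, Matrix.map_one _ ρr.map_zero ρr.map_one]
    have h3 : Matrix.fromBlocks wv 0 0 wv * Matrix.fromBlocks wv 0 0 wv = (1 : Matrix _ _ C(↥(bdry d), ℂ)) := by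
      rw [Matrix.fromBlocks_multiply]; simp [hww]
    calc L'.map ρr = L'.map ρr * (Matrix.fromBlocks wv 0 0 wv * Matrix.fromBlocks wv 0 0 wv) := by rw [h3, Matrix.mul_one]
      _ = Matrix.fromBlocks wv 0 0 wv := by rw [← Matrix.mul_assoc, h2, Matrix.one_mul]
  -- the conjugated constant idempotent over the cell
  set B : Matrix ((Fin n ⊕ Fin (m + ρ)) ⊕ (Fin n ⊕ Fin (m + ρ))) ((Fin n ⊕ Fin (m + ρ)) ⊕ (Fin n ⊕ Fin (m + ρ))) C(DD d, ℂ) :=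
    Matrix.fromBlocks (Matrix.fromBlocks 0 0 0 1) 0 0 0 with hB
  have hBi : IsIdempotentElem B :=
    isIdempotentElem_fromBlocks (isIdempotentElem_fromBlocks IsIdempotentElem.zero IsIdempotentElem.one) IsIdempotentElem.zero
  set QD := L' * B * L with hQD
  have hQDi : IsIdempotentElem QD := (AlgEquivalent.conj hBi hLL').isIdempotentElem_right
  -- its restriction to the boundary is `ĝ^*(P' ⊕ 0) ⊕ 0`
  have hwpw : wv * Matrix.fromBlocks 0 0 0 (1 : Matrix (Fin (m + ρ)) (Fin (m + ρ)) C(↥(bdry d), ℂ)) * wv = Matrix.fromBlocks p'.mat 0 0 0 := by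
    have h := hconj
    calc wv * Matrix.fromBlocks 0 0 0 1 * wv = wv * (wv * Matrix.fromBlocks p'.mat 0 0 0 * wv) * wv := by rw [h]
      _ = (wv * wv) * Matrix.fromBlocks p'.mat 0 0 0 * (wv * wv) := by simp only [Matrix.mul_assoc]
      _ = Matrix.fromBlocks p'.mat 0 0 0 := by rw [hww, Matrix.one_mul, Matrix.mul_one]
  have hQDρ : QD.map ρr = Matrix.fromBlocks (Matrix.fromBlocks p'.mat 0 0 0) 0 0 0 := by
    have hBρ : B.map ρr = Matrix.fromBlocks (Matrix.fromBlocks 0 0 0 1) 0 0 0 := by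
      simp only [hB, Matrix.fromBlocks_map, Matrix.map_zero _ ρr.map_zero, Matrix.map_one _ ρr.map_zero ρr.map_one]
    rw [hQD, Matrix.map_mul, Matrix.map_mul, hL'ρ, hLρ, hBρ]
    simp only [Matrix.fromBlocks_multiply, Matrix.mul_zero, Matrix.zero_mul, add_zero, hwpw]
  -- the idempotent over the sphere: `(P' ⊕ 0) ⊕ 0`
  set QS : Matrix ((Fin n ⊕ Fin (m + ρ)) ⊕ (Fin n ⊕ Fin (m + ρ))) ((Fin n ⊕ Fin (m + ρ)) ⊕ (Fin n ⊕ Fin (m + ρ))) C(SW d, ℂ) :=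
    Matrix.fromBlocks (Matrix.fromBlocks P'.mat 0 0 0) 0 0 0 with hQS
  have hQSi : IsIdempotentElem QS :=
    isIdempotentElem_fromBlocks (isIdempotentElem_fromBlocks P'.isIdempotentElem IsIdempotentElem.zero) IsIdempotentElem.zero
  have hQSρ : QS.map (comapRingHom (bdryToSW g e₀)) = Matrix.fromBlocks (Matrix.fromBlocks p'.mat 0 0 0) 0 0 0 := by
    simp only [hQS, Matrix.fromBlocks_map, Matrix.map_zero _ (map_zero _)]
    rfl
  -- compatibility along `ĝ`
  have hcompat : ∀ i j x (hx : rad x = 1), QD i j x = QS i j (bdryVal g e₀ x hx) := by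
    intro i j x hx
    have h1 : QD i j x = (QD.map ρr) i j ⟨x, hx⟩ := rfl
    have h2 : QS i j (bdryVal g e₀ x hx) = (QS.map (comapRingHom (bdryToSW g e₀))) i j ⟨x, hx⟩ := rfl
    rw [h1, h2, hQDρ, hQSρ]
  -- glue
  set Q := coneMat g e₀ QD QS hcompat with hQ
  have hQΦ : Q.map (comapRingHom (conePhi g e₀)) = QD := coneMat_map_conePhi g e₀ QD QS hcompat
  have hQj : Q.map (comapRingHom (coneJ g e₀)) = QS := coneMat_map_coneJ g e₀ QD QS hcompat
  have hQi : IsIdempotentElem Q := by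
    apply cone_matrix_ext g e₀
    · rw [Matrix.map_mul, hQΦ]; exact hQDi.eq
    · rw [Matrix.map_mul, hQj]; exact hQSi.eq
  refine ⟨Idem.ofMatrix Q hQi, m, ?_⟩
  -- the class on the sphere
  rw [pullback_of]
  have h1 : KZero.of ((Idem.ofMatrix Q hQi).map (comapRingHom (coneJ g e₀))) = KZero.of (Idem.ofMatrix QS hQSi) := by
    apply KZero.of_eq_of
    refine ((Idem.algEquivalent_ofMatrix Q hQi).map (comapRingHom (coneJ g e₀))).trans ?_
    rw [hQj]
    exact (Idem.algEquivalent_ofMatrix QS hQSi).symm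
  rw [h1]
  have h2 : AlgEquivalent QS P'.mat :=
    ((AlgEquivalent.fromBlocks_zero (isIdempotentElem_fromBlocks P'.isIdempotentElem IsIdempotentElem.zero)).trans
      (AlgEquivalent.fromBlocks_zero P'.isIdempotentElem))
  rw [KZero.of_eq_of ((Idem.algEquivalent_ofMatrix QS hQSi).trans h2), show KZero.of (⟨P'.size, P'.mat, P'.isIdempotentElem⟩ : Idem C(SW d, ℂ)) = KZero.of P' from rfl,
    hP', KZero.of_add, add_comm]

end Lift

end Literature.AlgebraicTopology.KTheory

end
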